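import Summits.AtomisticToContinuum.HydrodynamicLimit.Theorems.OneFlightGossipEngineClampedTransferDockOfInputs
import Summits.AtomisticToContinuum.HydrodynamicLimit.Theorems.OneFlightGossipEngineClampedTransferDockSeet
import HarnessLib

/-!
# The dock `ClampedTransferDock` and the binder `ClampedTransferDockOfInputs` from the four FILED route items
# (line `Sketch` of crux stmt-AtomisticToContinuum-17615, skeleton v6 §2; closes stmt-AtomisticToContinuum-17733)

The route planner (rev 32, judge-repair 2026-08-17) filed the four open conjecture-grade stubs of line `Sketch` as top-level cruxes,
each byte-identical with the registered stub signature: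

| filed item | route decl (`Theses.OneFlightGossipEngine.…`) | line-internal def it restates |
|---|---|---|
| stmt-17701 (crux r7) | `SuperExponentialEnergyTails` | `ClampedTransferDockCubicRate.SuperExponentialEnergyTails` |
| stmt-17700 (crux r5) | `BandCoherenceLDAlongFamilies` | `ClampedTransferDockCubicRate.BandCoherenceLDFamily` |
| stmt-17691 (crux r4) | `LocalClampedTransferLDAlongFamilies` | `HydroLimitInBandOfHeart.LocalClampedTransferWindowLDFamily` |
| stmt-17703 (crux r8) | `EnergyActivityTails` | `HydroLimitInBandOfHeart.CollisionEnergyActivityTails` |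

and re-bound `closes` to the glue `ClampedTransferDockOfInputs := SEET → BandCoherenceLDAlongFamilies →
LocalClampedTransferLDAlongFamilies → EnergyActivityTails → KineticCurrentsLDAlongFamilies → CollisionActivityTails → HydrodynamicLimit`
(stmt-17733). This file is the kernel check of the four identities (`Iff.rfl`) and the two one-line consequences of the LANDED
conditional closing `ClampedTransferDockSketch.clampedTransferDock_of_inputs` (p140743):

* `clampedTransferDock_of_routeItems` — the dock (stmt-17615) from the four filed items;
* `clampedTransferDockOfInputs_proof : ClampedTransferDockOfInputs` — the binder stmt-17733, ECT discharged by SEET at rate one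
  (`ClampedTransferDockSeet.seet_imp_energyCurrentTails`, p141132).

Quantifier plumbing over landed theorems only. [cite: Yau1991, §2]

prover-line-stmt-AtomisticToContinuum-17615-c1-0 (continuation lead, cycle 3).
-/

noncomputable section

namespace Summit.AtomisticToContinuum.HydrodynamicLimit.Theorems.ClampedTransferDockSketch

open Summit.AtomisticToContinuum.HydrodynamicLimit.Theses
open Summit.AtomisticToContinuum.HydrodynamicLimit.Theses.OneFlightGossipEngine
open Summit.AtomisticToContinuum.HydrodynamicLimit.Theorems

/-- The filed crux stmt-17701 is, as a term, the line's `SuperExponentialEnergyTails`. [cite: Yau1991, §2] -/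
theorem superExponentialEnergyTails_iff :
    Theses.OneFlightGossipEngine.SuperExponentialEnergyTails ↔ ClampedTransferDockCubicRate.SuperExponentialEnergyTails :=
  Iff.rfl

/-- The filed crux stmt-17700 is, as a term, the line's `BandCoherenceLDFamily`. [cite: Yau1991, §2] -/
theorem bandCoherenceLDAlongFamilies_iff :
    Theses.OneFlightGossipEngine.BandCoherenceLDAlongFamilies ↔ ClampedTransferDockCubicRate.BandCoherenceLDFamily :=
  Iff.rfl

/-- The filed crux stmt-17691 is, as a term, the heart's child (iii) `LocalClampedTransferWindowLDFamily`. [cite: Yau1991, §2] -/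
theorem localClampedTransferLDAlongFamilies_iff :
    Theses.OneFlightGossipEngine.LocalClampedTransferLDAlongFamilies ↔ HydroLimitInBandOfHeart.LocalClampedTransferWindowLDFamily :=
  Iff.rfl

/-- The filed crux stmt-17703 is, as a term, the heart's child (iv) `CollisionEnergyActivityTails`. [cite: Yau1991, §2] -/
theorem energyActivityTails_iff :
    Theses.OneFlightGossipEngine.EnergyActivityTails ↔ HydroLimitInBandOfHeart.CollisionEnergyActivityTails :=
  Iff.rfl

/-- **The dock `ClampedTransferDock` (stmt-17615) from the four filed route items** — the landed conditional closing
`clampedTransferDock_of_inputs` (p140743) transported along the four identities. [cite: Yau1991, §2] -/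
theorem clampedTransferDock_of_routeItems : Theses.OneFlightGossipEngine.SuperExponentialEnergyTails →
    Theses.OneFlightGossipEngine.BandCoherenceLDAlongFamilies → Theses.OneFlightGossipEngine.LocalClampedTransferLDAlongFamilies →
    Theses.OneFlightGossipEngine.EnergyActivityTails → Theses.OneFlightGossipEngine.ClampedTransferDock :=
  fun hS hB h₃ h₄ =>
    clampedTransferDock_of_inputs (superExponentialEnergyTails_iff.mp hS) (bandCoherenceLDAlongFamilies_iff.mp hB)
      (localClampedTransferLDAlongFamilies_iff.mp h₃) (energyActivityTails_iff.mp h₄)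

/-- **The binder of `closes`, `ClampedTransferDockOfInputs` (stmt-AtomisticToContinuum-17733), holds**: the dock from the four filed
items, with its antecedent ECT discharged by SEET at rate one (`ClampedTransferDockSeet.seet_imp_energyCurrentTails`, p141132).
[cite: Yau1991, §2] -/
theorem clampedTransferDockOfInputs_proof : Theses.OneFlightGossipEngine.ClampedTransferDockOfInputs :=
  fun hS hB h₃ h₄ hK h₇ =>
    clampedTransferDock_of_routeItems hS hB h₃ h₄ hK h₇
      (ClampedTransferDockSeet.seet_imp_energyCurrentTails (superExponentialEnergyTails_iff.mp hS))

end Summit.AtomisticToContinuum.HydrodynamicLimit.Theorems.ClampedTransferDockSketch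

end
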